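import Summits.AtomisticToContinuum.FouriersLaw.Theorems.OddSectorIrreversibilityCorrectorTheoryEnergy
import Summits.AtomisticToContinuum.FouriersLaw.Theorems.OddSectorIrreversibilityCorrectorTheorySiteEnergy
import Summits.AtomisticToContinuum.FouriersLaw.Theorems.OddSectorIrreversibilityCorrectorTheoryExistence

/-!
# `CorrectorTheory` (stmt-AtomisticToContinuum-14071), part 6b: the bond sum rule

Helper file for support item `stmt-AtomisticToContinuum-14071`
(`OddSectorIrreversibility.CorrectorTheory`, conjunct A (5)).

For the pinned anharmonic chain `P = pinnedChain ω₂ lam β γ` (`ω₂ > 0`, `lam, β ≥ 0`, `γ > 0`),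
`T > 0`, `ρ = e^{-H/T}`, and a classical solution `u ∈ C² ∩ L²(μ_T)` of `L_{T,T} u = -k` with a
continuous ODD source `k ∈ L²(μ_T)` (`k(q,-p) = -k(q,p)`; the Kubo corrector with `k = J`):

* `bond_sum_rule_density` — `∫ u j_i ρ dx = ∫ u j_{i+1} ρ dx` whenever site `m = i+1` is
  interior (`m + 1 < N`): with the site energy `h_m` (`X_H h_m = j_i - j_m`, part 6a),
  `⟨u, X_H h_m⟩ = -⟨X_H u, h_m⟩ = ⟨k + γ S u, h_m⟩ = 0 + γ⟨u, S h_m⟩ = 0`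
  (`h_m` is even, `k` odd; `h_m` does not see the bath momenta) — made honest with the energy
  cutoffs `χ_n` of the tree's Kubo calculus (`integral_chi_liouville_antisymm`,
  `integral_chi_mul_bathOp`) and dominated convergence;
* `bond_sum_rule` — the same against the unnormalised Gibbs weight `e^{-H/T} dq dp`, in the
  vocabulary of the route decl.

References: Kundu–Dhar–Narayan 2009 (reln3); Bonetto–Lebowitz–Rey-Bellet 2000 §5.2. Nothing here
closes the item.
-/

noncomputable section

open MeasureTheory Filter Topology ProbabilityTheory
open scoped ContDiff NNReal ENNReal
open Literature.MathematicalPhysics.KineticTheory.HeatConduction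
open Summit.AtomisticToContinuum.FouriersLaw.Theorems.SuperadditiveResistance.DeviceLiouville
open Summit.AtomisticToContinuum.FouriersLaw.Theorems.SuperadditiveResistance.Kubo
open Summit.AtomisticToContinuum.FouriersLaw.Theorems.LightConeBondHeat

namespace Summit.AtomisticToContinuum.FouriersLaw.Theorems.OddSectorIrreversibility.Corrector

variable {N : ℕ}

section Pinned

variable {ω₂ lam β γ : ℝ} (hω : 0 < ω₂) (hl : 0 ≤ lam) (hβ : 0 ≤ β) {T : ℝ} (hT : 0 < T)
include hω hl hβ hT

/-- Continuous observables of exponential class `|f| ≤ C e^{ϑH}` with `2ϑ < 1/T` are in `L²(μ_T)`.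
[folklore] -/
theorem memLp_two_of_abs_le_exp (γ : ℝ) {f : PhaseSpace N → ℝ} (hf : Continuous f) {C ϑ : ℝ}
    (h2ϑ : 2 * ϑ < 1 / T)
    (hb : ∀ y, |f y| ≤ C * Real.exp (ϑ * (pinnedChain ω₂ lam β γ).hamiltonian N y)) :
    MemLp f 2 ((pinnedChain ω₂ lam β γ).gibbsMeasure N T) := by
  rw [memLp_two_iff_integrable_sq hf.aestronglyMeasurable]
  have h := pinnedChain_integrable_exp_mul_hamiltonian_gibbsMeasure hω hl hβ γ N hT h2ϑ
  refine (h.const_mul (C ^ 2)).mono' (hf.pow 2).aestronglyMeasurable (Eventually.of_forall fun y => ?_)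
  rw [Real.norm_eq_abs, abs_pow]
  have hC : 0 ≤ C * Real.exp (ϑ * (pinnedChain ω₂ lam β γ).hamiltonian N y) := (abs_nonneg _).trans (hb y)
  calc |f y| ^ 2 ≤ (C * Real.exp (ϑ * (pinnedChain ω₂ lam β γ).hamiltonian N y)) ^ 2 :=
        pow_le_pow_left₀ (abs_nonneg _) (hb y) 2
    _ = C ^ 2 * Real.exp (2 * ϑ * (pinnedChain ω₂ lam β γ).hamiltonian N y) := by
        rw [mul_pow, sq (Real.exp _), ← Real.exp_add]; ring_nf

/-- The bond currents are in `L²(μ_T)`. [folklore] -/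
theorem memLp_bondCurrent (γ : ℝ) (i : Fin N) :
    MemLp (fun x => (pinnedChain ω₂ lam β γ).bondCurrent N i x) 2 ((pinnedChain ω₂ lam β γ).gibbsMeasure N T) := by
  have hϑ : 0 < 1 / (4 * T) := by positivity
  have h2ϑ : 2 * (1 / (4 * T)) < 1 / T := by
    rw [show 2 * (1 / (4 * T)) = 1 / (2 * T) by field_simp; ring, div_lt_div_iff₀ (by positivity) hT]
    nlinarith
  exact memLp_two_of_abs_le_exp hω hl hβ hT γ (pinnedChain_continuous_bondCurrent ω₂ lam β γ N i) h2ϑ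
    (pinnedChain_abs_bondCurrent_le_exp hω.le hl hβ γ N hϑ i)

/-- A continuous `f` with `0 ≤ f ≤ H` is in `L²(μ_T)`. [folklore] -/
theorem memLp_two_of_le_hamiltonian (γ : ℝ) {f : PhaseSpace N → ℝ} (hf : Continuous f)
    (h0 : ∀ x, 0 ≤ f x) (hH : ∀ x, f x ≤ (pinnedChain ω₂ lam β γ).hamiltonian N x) :
    MemLp f 2 ((pinnedChain ω₂ lam β γ).gibbsMeasure N T) := by
  set ϑ : ℝ := 1 / (4 * T) with hϑd
  have hϑ : 0 < ϑ := by positivity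
  have h2ϑ : 2 * ϑ < 1 / T := by
    rw [hϑd, show 2 * (1 / (4 * T)) = 1 / (2 * T) by field_simp; ring, div_lt_div_iff₀ (by positivity) hT]
    nlinarith
  refine memLp_two_of_abs_le_exp hω hl hβ hT γ hf (C := 1 / ϑ) h2ϑ fun y => ?_
  rw [abs_of_nonneg (h0 y)]
  have hx : ϑ * (pinnedChain ω₂ lam β γ).hamiltonian N y ≤ Real.exp (ϑ * (pinnedChain ω₂ lam β γ).hamiltonian N y) :=
    (by linarith [Real.add_one_le_exp (ϑ * (pinnedChain ω₂ lam β γ).hamiltonian N y)])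
  calc f y ≤ (pinnedChain ω₂ lam β γ).hamiltonian N y := hH y
    _ = 1 / ϑ * (ϑ * (pinnedChain ω₂ lam β γ).hamiltonian N y) := by field_simp
    _ ≤ 1 / ϑ * Real.exp (ϑ * (pinnedChain ω₂ lam β γ).hamiltonian N y) :=
        mul_le_mul_of_nonneg_left hx (by positivity)

variable (hγ : 0 < γ)
include hγ

/-- **The bond sum rule (density form).** For `u ∈ C² ∩ L²(μ_T)`, a continuous odd `k ∈ L²(μ_T)`
with `L_{T,T} u = -k` pointwise, and consecutive bonds `i`, `i' = i + 1` with site `i'` interior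
(`i' + 1 < N`): `∫ u j_i e^{-H/T} dx = ∫ u j_{i'} e^{-H/T} dx`. [folklore] -/
theorem bond_sum_rule_density {u k : PhaseSpace N → ℝ} (hu : ContDiff ℝ 2 u)
    (hu2 : MemLp u 2 ((pinnedChain ω₂ lam β γ).gibbsMeasure N T)) (hkc : Continuous k)
    (hk2 : MemLp k 2 ((pinnedChain ω₂ lam β γ).gibbsMeasure N T))
    (hkodd : ∀ x : PhaseSpace N, k (x.1, -x.2) = -k x)
    (hpde : ∀ x, (pinnedChain ω₂ lam β γ).generator N T T u x = -k x)
    {i i' : Fin N} (hii' : i'.val = i.val + 1) (hint : i'.val + 1 < N) :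
    ∫ x, u x * (pinnedChain ω₂ lam β γ).bondCurrent N i x * (pinnedChain ω₂ lam β γ).gibbsDensity N T x =
      ∫ x, u x * (pinnedChain ω₂ lam β γ).bondCurrent N i' x * (pinnedChain ω₂ lam β γ).gibbsDensity N T x := by
  set P := pinnedChain ω₂ lam β γ with hP
  set ρ := P.gibbsDensity N T with hρ
  set B := OscillatorChain.bathWeight N with hB
  have hU : ContDiff ℝ ∞ P.U := pinnedChain_contDiff_U ω₂ lam β γ
  have hV : ContDiff ℝ ∞ P.V := pinnedChain_contDiff_V ω₂ lam β γ
  have hUd : Differentiable ℝ P.U := hU.differentiable (by simp)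
  have hVd : Differentiable ℝ P.V := hV.differentiable (by simp)
  have hU0 : ∀ q, 0 ≤ P.U q := fun q => by show 0 ≤ ω₂ * q ^ 2 / 2 + lam * q ^ 4 / 4; positivity
  have hV0 : ∀ r, 0 ≤ P.V r := fun r => by show 0 ≤ r ^ 2 / 2 + β * r ^ 4 / 4; positivity
  -- the site energy of the interior site `m = i'`
  set m := i' with hm
  set e : PhaseSpace N → ℝ := fun x => (∑ k : Fin N, (if k = m then (1 : ℝ) else 0) *
      (x.2 k ^ 2 / 2 + P.U (x.1 k))) + ∑ k : Fin N, ∑ l : Fin N,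
      if l.val = k.val + 1 then ((if k = m then (1 : ℝ) else 0) + (if l = m then (1 : ℝ) else 0)) / 2 *
        P.V (x.1 l - x.1 k) else 0 with he
  have hes : ContDiff ℝ ∞ e := by
    refine (ContDiff.sum fun k _ => contDiff_const.mul ((((contDiff_apply ℝ ℝ k).comp contDiff_snd).pow 2
      |>.div_const 2).add (hU.comp ((contDiff_apply ℝ ℝ k).comp contDiff_fst)))).add
      (ContDiff.sum fun k _ => ContDiff.sum fun l _ => ?_)
    split_ifs <;> first
      | exact contDiff_const.mul (hV.comp (((contDiff_apply ℝ ℝ l).comp contDiff_fst).sub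
          ((contDiff_apply ℝ ℝ k).comp contDiff_fst)))
      | exact contDiff_const
  have he2 : ContDiff ℝ 2 e := hes.of_le (by norm_cast)
  have hec : Continuous e := hes.continuous
  have hLe : ∀ x, liouvilleOp P N e x = P.bondCurrent N i x - P.bondCurrent N m x :=
    fun x => liouvilleOp_siteEnergy P m e he hUd hVd hii' x
  have hm0 : m.val ≠ 0 := by omega
  have hmN : m.val ≠ N - 1 := by omega
  have hBm : B m = 0 := by simp [hB, OscillatorChain.bathWeight, hm0, hmN]
  have hde : ∀ b : Fin N, b ≠ m → partialP b e = fun _ => 0 := fun b hb =>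
    partialP_siteEnergy_of_ne P m e he hb
  have hBde : ∀ (b : Fin N) (F : PhaseSpace N → ℝ), B b * ∫ x, F x * partialP b e x * ρ x = 0 := by
    intro b F
    by_cases hb : b = m
    · rw [hb, hBm, zero_mul]
    · simp [hde b hb]
  have hSe : ∀ x, bathOp N B T e x = 0 := by
    intro x
    unfold bathOp
    refine Finset.sum_eq_zero fun b _ => ?_
    by_cases hb : b = m
    · rw [hb, hBm, zero_mul]
    · have h1 : partialP b e = fun _ => 0 := hde b hb
      have h2 : partialP b (partialP b e) x = 0 := by rw [h1]; simp [partialP]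
      rw [h2, h1]; ring
  -- parity and size of `e`
  have heven : ∀ x : PhaseSpace N, e (x.1, -x.2) = e x := fun x => siteEnergy_neg_momentum P m e he x
  have he0 : ∀ x, 0 ≤ e x := fun x => siteEnergy_nonneg P m e he hU0 hV0 x
  have heH : ∀ x, e x ≤ P.hamiltonian N x := fun x => siteEnergy_le_hamiltonian P m e he hU0 hV0 x
  have hem2 : MemLp e 2 (P.gibbsMeasure N T) := memLp_two_of_le_hamiltonian hω hl hβ hT γ hec he0 heH
  -- the Poisson equation in operator form and the `L²` facts
  have hpde' : ∀ x, liouvilleOp P N u x = -k x - γ * bathOp N B T u x := fun x => by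
    have := hpde x; rw [generator_eq_liouvilleOp_add] at this
    change liouvilleOp P N u x + γ * bathOp N B T u x = -k x at this; linarith
  have hu1 : ContDiff ℝ 1 u := hu.of_le (by norm_cast)
  have huc : Continuous u := hu.continuous
  have hduc : ∀ b, Continuous (partialP b u) := fun b => continuous_partialP hu1 one_ne_zero b
  have hdu2 : ∀ {b : Fin N}, 0 < B b → MemLp (partialP b u) 2 (P.gibbsMeasure N T) := fun {b} hb =>
    memLp_partialP_of_poisson hω hl hβ hγ hT hu hu2 hk2 hpde hb
  have hji : ∀ j : Fin N, MemLp (fun x => P.bondCurrent N j x) 2 (P.gibbsMeasure N T) :=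
    fun j => memLp_bondCurrent hω hl hβ hT γ j
  -- cutoffs, density
  have hHs : ContDiff ℝ ∞ (P.hamiltonian N) := P.contDiff_hamiltonian hU hV N
  have hχc : ∀ n, Continuous (chi P N n) := fun n => (contDiff_chi hHs n).continuous
  have hχcs : ∀ n, HasCompactSupport (chi P N n) := fun n => hasCompactSupport_chi hω hl hβ γ N n
  have hρc : Continuous ρ := pinnedChain_continuous_gibbsDensity ω₂ lam β γ N T
  have hχbdd : ∀ n x, ‖chi P N n x‖ ≤ 1 := fun n x => by rw [Real.norm_eq_abs]; exact abs_chi_le_one n x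
  -- `L¹` facts
  have hujL1 : Integrable fun x => (u x * (P.bondCurrent N i x - P.bondCurrent N m x)) * ρ x := by
    have := integrable_mul_mul_gibbsDensity hω hl hβ γ N hT hu2 ((hji i).sub (hji m))
    refine this.congr (Eventually.of_forall fun x => ?_)
    simp only [Pi.sub_apply]
    rfl
  have hekL1 : Integrable fun x => (e x * k x) * ρ x := integrable_mul_mul_gibbsDensity hω hl hβ γ N hT hem2 hk2
  have hχuj : ∀ n, Integrable fun x => chi P N n x * (u x * (P.bondCurrent N i x - P.bondCurrent N m x)) * ρ x :=
    fun n => (hujL1.bdd_mul (hχc n).aestronglyMeasurable (Eventually.of_forall (hχbdd n))).congr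
      (Eventually.of_forall fun x => by ring)
  have hχek : ∀ n, Integrable fun x => chi P N n x * (e x * k x) * ρ x :=
    fun n => (hekL1.bdd_mul (hχc n).aestronglyMeasurable (Eventually.of_forall (hχbdd n))).congr
      (Eventually.of_forall fun x => by ring)
  -- the level-`n` identity
  have hlevel : ∀ n : ℕ, ∫ x, chi P N n x * (u x * (P.bondCurrent N i x - P.bondCurrent N m x)) * ρ x =
      (∫ x, chi P N n x * (e x * k x) * ρ x) -
        γ * T * ∑ b, B b * ∫ x, e x * partialP b (chi P N n) x * partialP b u x * ρ x := by
    intro n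
    have hanti := integral_chi_liouville_antisymm hω hl hβ γ N hT.ne' hu he2 n
    have hbath := integral_chi_mul_bathOp hω hl hβ γ N B hT.ne' he2 hu n
    -- `∫ χ e (S u) ρ = -T Σ_b B_b ∫ e ∂χ ∂u ρ` (the `∂e` terms vanish)
    have hbath' : ∫ x, chi P N n x * e x * bathOp N B T u x * ρ x =
        -T * ∑ b, B b * ∫ x, e x * partialP b (chi P N n) x * partialP b u x * ρ x := by
      rw [hbath]
      congr 1
      refine Finset.sum_congr rfl fun b _ => ?_
      by_cases hb : b = m
      · rw [hb, hBm, zero_mul, zero_mul]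
      · have h0' : ∫ x, chi P N n x * partialP b e x * partialP b u x * ρ x = 0 := by
          simp [hde b hb]
        rw [h0', zero_add]
    -- pointwise: `χ(u X_H e + e X_H u) = χ u (j_i - j_m) - χ e k - γ χ e (S u)`
    have hpt : ∀ x, chi P N n x * (u x * liouvilleOp P N e x + e x * liouvilleOp P N u x) * ρ x =
        chi P N n x * (u x * (P.bondCurrent N i x - P.bondCurrent N m x)) * ρ x -
          chi P N n x * (e x * k x) * ρ x - γ * (chi P N n x * e x * bathOp N B T u x * ρ x) := by
      intro x; rw [hLe, hpde']; ring
    have hI1 : Integrable fun x => chi P N n x * (u x * (P.bondCurrent N i x - P.bondCurrent N m x)) * ρ x :=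
      hχuj n
    have hI2 : Integrable fun x => chi P N n x * (e x * k x) * ρ x := hχek n
    have hI3 : Integrable fun x => γ * (chi P N n x * e x * bathOp N B T u x * ρ x) :=
      ((((hχc n).mul hec).mul (continuous_bathOp hu B T)).mul hρc).integrable_of_hasCompactSupport
        (((hχcs n).mul_right).mul_right.mul_right) |>.const_mul γ
    have h0 : ∫ x, (chi P N n x * (u x * (P.bondCurrent N i x - P.bondCurrent N m x)) * ρ x -
        chi P N n x * (e x * k x) * ρ x - γ * (chi P N n x * e x * bathOp N B T u x * ρ x)) = 0 := by
      rw [← hanti]; exact integral_congr_ae (Eventually.of_forall fun x => (hpt x).symm)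
    have hI12 : Integrable fun x => chi P N n x * (u x * (P.bondCurrent N i x - P.bondCurrent N m x)) * ρ x -
        chi P N n x * (e x * k x) * ρ x := hI1.sub hI2
    rw [integral_sub hI12 hI3, integral_sub hI1 hI2, integral_const_mul, hbath'] at h0
    linarith
  -- the limits `n → ∞`
  have hlimL : Tendsto (fun n : ℕ => ∫ x, chi P N n x * (u x * (P.bondCurrent N i x - P.bondCurrent N m x)) * ρ x)
      atTop (𝓝 (∫ x, (u x * (P.bondCurrent N i x - P.bondCurrent N m x)) * ρ x)) :=
    tendsto_integral_chi_mul hω.le hl hβ γ N T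
      ((huc.mul ((pinnedChain_continuous_bondCurrent ω₂ lam β γ N i).sub
        (pinnedChain_continuous_bondCurrent ω₂ lam β γ N m))).aestronglyMeasurable) hujL1
  have hlim1 : Tendsto (fun n : ℕ => ∫ x, chi P N n x * (e x * k x) * ρ x) atTop (𝓝 (∫ x, (e x * k x) * ρ x)) :=
    tendsto_integral_chi_mul hω.le hl hβ γ N T ((hec.mul hkc).aestronglyMeasurable) hekL1
  have hek0 : ∫ x, (e x * k x) * ρ x = 0 :=
    integral_mul_gibbsDensity_eq_zero_of_odd P N T (g := fun x => e x * k x) fun x => by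
      simp only [heven x, hkodd x]; ring
  have hlim2 : ∀ b : Fin N, Tendsto (fun n : ℕ => B b * ∫ x, e x * partialP b (chi P N n) x * partialP b u x * ρ x)
      atTop (𝓝 (B b * 0)) := by
    intro b
    rcases (bathWeight_nonneg N b).eq_or_lt with hb | hb
    · have hBb : B b = 0 := hb.symm
      simp only [hBb, zero_mul]
      exact tendsto_const_nhds
    · refine Tendsto.const_mul _ ?_
      have hF : Integrable fun x => (e x * partialP b u x) * ρ x :=
        integrable_mul_mul_gibbsDensity hω hl hβ γ N hT hem2 (hdu2 hb)
      have h := tendsto_integral_partialP_chi_mul hω hl hβ γ N T b ((hec.mul (hduc b)).aestronglyMeasurable) hF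
      have e1 : (fun n : ℕ => ∫ x, e x * partialP b (chi P N n) x * partialP b u x * ρ x) =
          fun n => ∫ x, partialP b (chi P N n) x * (e x * partialP b u x) * ρ x := by
        funext n; exact integral_congr_ae (Eventually.of_forall fun x => by ring)
      rw [e1]; exact h
  have hlimR : Tendsto (fun n : ℕ => (∫ x, chi P N n x * (e x * k x) * ρ x) -
      γ * T * ∑ b, B b * ∫ x, e x * partialP b (chi P N n) x * partialP b u x * ρ x) atTop
      (𝓝 ((∫ x, (e x * k x) * ρ x) - γ * T * ∑ b : Fin N, B b * 0)) :=
    hlim1.sub ((tendsto_finsetSum _ fun b _ => hlim2 b).const_mul _)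
  have heq : ∫ x, (u x * (P.bondCurrent N i x - P.bondCurrent N m x)) * ρ x =
      (∫ x, (e x * k x) * ρ x) - γ * T * ∑ b : Fin N, B b * 0 :=
    tendsto_nhds_unique (hlimL.congr fun n => hlevel n) hlimR
  rw [hek0] at heq
  simp only [mul_zero, Finset.sum_const_zero, sub_zero] at heq
  -- split the vanishing integral
  have hIi : Integrable fun x => u x * P.bondCurrent N i x * ρ x :=
    integrable_mul_mul_gibbsDensity hω hl hβ γ N hT hu2 (hji i)
  have hIm : Integrable fun x => u x * P.bondCurrent N m x * ρ x :=
    integrable_mul_mul_gibbsDensity hω hl hβ γ N hT hu2 (hji m)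
  have hsplit : ∫ x, (u x * (P.bondCurrent N i x - P.bondCurrent N m x)) * ρ x =
      (∫ x, u x * P.bondCurrent N i x * ρ x) - ∫ x, u x * P.bondCurrent N m x * ρ x := by
    rw [← integral_sub hIi hIm]
    exact integral_congr_ae (Eventually.of_forall fun x => by ring)
  rw [hsplit] at heq
  linarith

/-- **The bond sum rule in the vocabulary of `CorrectorTheory` (5)**: under the hypotheses of
`bond_sum_rule_density`, `∫ u j_i dμ_T = ∫ u j_{i'} dμ_T` for the unnormalised Gibbs weight
`μ_T = e^{-H/T} dq dp`, consecutive bonds `i' = i + 1` with `i' + 1 < N`. [folklore] -/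
theorem bond_sum_rule {u k : PhaseSpace N → ℝ} (hu : ContDiff ℝ 2 u)
    (hu2 : MemLp u 2 ((pinnedChain ω₂ lam β γ).gibbsMeasure N T)) (hkc : Continuous k)
    (hk2 : MemLp k 2 ((pinnedChain ω₂ lam β γ).gibbsMeasure N T))
    (hkodd : ∀ x : PhaseSpace N, k (x.1, -x.2) = -k x)
    (hpde : ∀ x, (pinnedChain ω₂ lam β γ).generator N T T u x = -k x)
    {i i' : Fin N} (hii' : i'.val = i.val + 1) (hint : i'.val + 1 < N) :
    ∫ x, u x * (pinnedChain ω₂ lam β γ).bondCurrent N i x ∂((volume : Measure (PhaseSpace N)).withDensity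
        (fun x => ENNReal.ofReal (Real.exp (-((pinnedChain ω₂ lam β γ).hamiltonian N x) / T)))) =
      ∫ x, u x * (pinnedChain ω₂ lam β γ).bondCurrent N i' x ∂((volume : Measure (PhaseSpace N)).withDensity
        (fun x => ENNReal.ofReal (Real.exp (-((pinnedChain ω₂ lam β γ).hamiltonian N x) / T)))) := by
  have hU : Continuous (pinnedChain ω₂ lam β γ).U := (pinnedChain_contDiff_U ω₂ lam β γ (n := 0)).continuous
  have hV : Continuous (pinnedChain ω₂ lam β γ).V := (pinnedChain_contDiff_V ω₂ lam β γ (n := 0)).continuous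
  simp only [integral_withDensity_gibbs _ hU hV]
  exact bond_sum_rule_density hω hl hβ hT hγ hu hu2 hkc hk2 hkodd hpde hii' hint

end Pinned

end Summit.AtomisticToContinuum.FouriersLaw.Theorems.OddSectorIrreversibility.Corrector

end
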